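import Summits.QuantumFields.BalabanUV.Beta.GAN24.DerivativeRateTransferJensenMassFreePoincare

/-!
# `BalabanUV.Beta.GAN24.DerivativeRateTransferJensenMassFreeCoercive` — binder row G-an2-4 ∕ (CONV-C), route R6 «VALUES, NOT DERIVATIVES», PART 93:
# COERCIVITY ON THE CONSTRAINT KERNEL FROM THE BLOCK POINCARÉ DATUM — the `hcoer` of PART 92's `mismatch_sq_le_of_coercive` (`Qz = 0 → γ⟨z,z⟩ ≤ ⟨z,H_fz⟩`)
# is the block Poincaré inequality read on fluctuations: for `Qz = 0` the block variance IS the block mass, so any Poincaré datum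
# `Σ_x q(y,x)|W(y,x)z(x) − (Qz)(y)|² ≤ Φ_z(y)` with `Σ_yΦ_z(y) ≤ ϖ₀⟨z,H_fz⟩` and covering weights `Σ_y q(y,x) ≥ c₀` gives `c₀⟨z,z⟩ ≤ ϖ₀⟨z,H_fz⟩`; on the block
# lattice (PART 64's comb datum) `γ = (L^d)⁻¹·w_f ∕ (4(d(L−1))²)` (unit b2b-balaban-gan24-p3, gen 47; v1)

NOT IN PRINT; OUR PROOF (for the ROUTE; [folklore] — PART 64's `blockVar_comb_le` ∕ `sum_blockEnergy_eq` ∕ `nxt_eq_update` and PART 22 ∕ 24's lattice letters BY NAME).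
HONEST FRAMING (cell contract, verbatim): «discharging `BetaPertH` makes Bałaban's UV stability UNCONDITIONAL — a real constructive-QFT result; it is NOT the continuum
limit and NOT the Clay problem.»  HONEST DEPENDENCY (verbatim): «continuum YM on T⁴ ⇐ BetaPertH ∧ nine spine estimates (0/9 proved); BetaPertH ⇐ (D1) ∧ (D4) ∧
CAP+tail; G-an2-4 gates asym, D1 and NE2/3/4.»

WHAT THIS FILE PROVES (0 sorry, 0 `def`, nothing cited):
* §1 `dotProduct_self_mulVec_orth` (`WᵀW = 1 ⟹ |Wv|² = |v|²`), `mass_le_blockVar_of_fluctuation` (`Qz = 0 ⟹ c₀⟨z,z⟩ ≤ Σ_yΦ(y)`),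
  **`coercive_of_blockPoincare`** (abstract: orthogonal block transporters, covering weights
  `c₀ ≤ Σ_y q(y,x)`, a fluctuation `Qz = 0` with block Poincaré datum `Φ` and budget `Σ_yΦ(y) ≤ ϖ₀·⟨z,H_fz⟩` ⟹ `c₀·⟨z,z⟩ ≤ ϖ₀·⟨z,H_fz⟩`).
* §2 **`coercive_lattice`** (the block lattice with PART 64's comb: gauge field `R`, orthogonal comb `W`, averaging `Q` with entries `(L^d)⁻¹`, `H_f ≥ w_f·Σ_e|R_ez(tgt) − z(src)|²`,
  `0 ≤ w_f`, `Qz = 0` ⟹ `((L^d)⁻¹·w_f)·⟨z,z⟩ ≤ 4(d(L−1))²·⟨z,H_fz⟩` — one scale; at tower level `j` use `L^j` for `L`).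
WHAT IT DOES NOT DO: supply coercivity WITH the constraint term `aQ*Q` off the kernel (Bałaban's `Δ_a` positivity, [CMP 102-var (142)]) or for his covariant
Laplacian; convert PART 92's energy bound into link letters (the links-vs-fields dictionary).  SUPPLIER work on route R6 (rank 2, REDUCTION, no seat); no consumer
of record; NEVER «G-an2-4 closed»; NOT (CONV-C), NOT D1, NOT `BetaPertH`, NOT continuum, NOT Clay.  Records: `HOME/b2b-balaban-gan24-p3/WOODBURY-FIBRE.md` v14.7.
-/

noncomputable section

open Matrix Finset Function

namespace Summit.QuantumFields.BalabanUV.Beta.GAN24.DerivativeRateTransferJensenMassFreeCoercive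

open Summit.QuantumFields.BalabanUV.Beta.GAN24.DerivativeRateTransferLoewnerKKT (mulVec_dotProduct_eq)
open Summit.QuantumFields.BalabanUV.Beta.GAN24.DerivativeRateTransferJensenChain (dotProduct_self_nonneg')
open Summit.QuantumFields.BalabanUV.Beta.GAN24.DerivativeRateTransferJensen (dotProduct_self_eq_sum_sites)
open Summit.QuantumFields.BalabanUV.Beta.GAN24.DerivativeRateTransferJensenLattice
open Summit.QuantumFields.BalabanUV.Beta.GAN24.DerivativeRateTransferJensenMassFreePoincare

/-! ## §1 Abstract: the Poincaré datum on a fluctuation is a coercivity bound -/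

section Abstract

variable {o μ ν : Type*} [Fintype o] [DecidableEq o] [Fintype μ] [Fintype ν]
variable {q : μ → ν → ℝ} {W : μ → ν → Matrix o o ℝ} {Q : Matrix (μ × o) (ν × o) ℝ} {Hf : Matrix (ν × o) (ν × o) ℝ}

omit [Fintype μ] [Fintype ν] in
/-- `WᵀW = 1 ⟹ |Wv|² = |v|²`. [folklore] -/
theorem dotProduct_self_mulVec_orth {V : Matrix o o ℝ} (hV : Vᵀ * V = 1) (v : o → ℝ) : (V *ᵥ v) ⬝ᵥ (V *ᵥ v) = v ⬝ᵥ v := by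
  rw [mulVec_dotProduct_eq, mulVec_mulVec, hV, one_mulVec]

/-- **`mass_le_blockVar_of_fluctuation` — ON A FLUCTUATION THE VARIANCE IS THE MASS** [our proof]: orthogonal block transporters `W(y,x)`, nonnegative
block weights with the COVERING letter `c₀ ≤ Σ_y q(y,x)` for every fine site, a fluctuation `Qz = 0` whose block variances obey
`Σ_x q(y,x)|W(y,x)z(x) − (Qz)(y)|² ≤ Φ(y)` ⟹ `c₀·⟨z,z⟩ ≤ Σ_y Φ(y)`. -/
theorem mass_le_blockVar_of_fluctuation (hW : ∀ y x, (W y x)ᵀ * W y x = 1) {c₀ : ℝ}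
    (hcover : ∀ x, c₀ ≤ ∑ y, q y x) (z : ν × o → ℝ) (hz : Q *ᵥ z = 0) {Φ : μ → ℝ}
    (hP : ∀ y, ∑ x, q y x * (((W y x *ᵥ fun b => z (x, b)) - fun a => (Q *ᵥ z) (y, a)) ⬝ᵥ
        ((W y x *ᵥ fun b => z (x, b)) - fun a => (Q *ᵥ z) (y, a))) ≤ Φ y) :
    c₀ * (z ⬝ᵥ z) ≤ ∑ y, Φ y := by
  -- on a fluctuation the block variance at `y` is `Σ_x q(y,x)|z(x)|²`
  have hvar : ∀ y, ∑ x, q y x * (((W y x *ᵥ fun b => z (x, b)) - fun a => (Q *ᵥ z) (y, a)) ⬝ᵥ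
      ((W y x *ᵥ fun b => z (x, b)) - fun a => (Q *ᵥ z) (y, a))) = ∑ x, q y x * ((fun b => z (x, b)) ⬝ᵥ fun b => z (x, b)) := fun y => by
    refine Finset.sum_congr rfl fun x _ => ?_
    have h0 : (fun a => (Q *ᵥ z) (y, a)) = 0 := by funext a; rw [hz]; rfl
    rw [h0, sub_zero, dotProduct_self_mulVec_orth (hW y x)]
  have h1 : c₀ * (z ⬝ᵥ z) ≤ ∑ y, ∑ x, q y x * ((fun b => z (x, b)) ⬝ᵥ fun b => z (x, b)) := by
    rw [Finset.sum_comm, dotProduct_self_eq_sum_sites z, Finset.mul_sum]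
    refine Finset.sum_le_sum fun x _ => ?_
    rw [← Finset.sum_mul]
    exact mul_le_mul_of_nonneg_right (hcover x) (dotProduct_self_nonneg' _)
  have h2 : ∑ y, ∑ x, q y x * ((fun b => z (x, b)) ⬝ᵥ fun b => z (x, b)) ≤ ∑ y, Φ y :=
    Finset.sum_le_sum fun y _ => by rw [← hvar y]; exact hP y
  exact h1.trans h2

/-- **`coercive_of_blockPoincare` — COERCIVITY ON `ker Q` FROM A BLOCK POINCARÉ DATUM** [our proof]: with moreover the budget `Σ_y Φ(y) ≤ ϖ₀·⟨z,H_fz⟩`: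
`c₀·⟨z,z⟩ ≤ ϖ₀·⟨z,H_fz⟩` — the `hcoer` of PART 92's `mismatch_sq_le_of_coercive` with `γ = c₀∕ϖ₀`. -/
theorem coercive_of_blockPoincare (hW : ∀ y x, (W y x)ᵀ * W y x = 1) {c₀ ϖ₀ : ℝ}
    (hcover : ∀ x, c₀ ≤ ∑ y, q y x) (z : ν × o → ℝ) (hz : Q *ᵥ z = 0) {Φ : μ → ℝ}
    (hP : ∀ y, ∑ x, q y x * (((W y x *ᵥ fun b => z (x, b)) - fun a => (Q *ᵥ z) (y, a)) ⬝ᵥ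
        ((W y x *ᵥ fun b => z (x, b)) - fun a => (Q *ᵥ z) (y, a))) ≤ Φ y)
    (hΦ : ∑ y, Φ y ≤ ϖ₀ * (z ⬝ᵥ (Hf *ᵥ z))) :
    c₀ * (z ⬝ᵥ z) ≤ ϖ₀ * (z ⬝ᵥ (Hf *ᵥ z)) :=
  (mass_le_blockVar_of_fluctuation hW hcover z hz hP).trans hΦ

end Abstract

/-! ## §2 The block lattice: `γ = (L^d)⁻¹·w_f ∕ (4(d(L−1))²)` from PART 64's comb datum -/

section Lattice

variable {d L M : ℕ} {o : Type*} [Fintype o] [DecidableEq o]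

/-- **`coercive_lattice` — COERCIVITY OF THE FINE FORM ON FLUCTUATIONS OF THE BLOCK-MEAN CONSTRAINT** [our proof; PART 64 `blockVar_comb_le` BY NAME]: lattice
gauge field `R` (orthogonality not needed here), the COMB block transporters `W` (orthogonal), the averaging `Q` (entries `(L^d)⁻¹`, transported by `W`), a fine form `H_f ≥ w_f·Σ_e|R_ez(tgt e) − z(src e)|²`
with `0 ≤ w_f` ⟹ for every fluctuation `Qz = 0`: `((L^d)⁻¹·w_f)·⟨z,z⟩ ≤ 4(d(L−1))²·⟨z,H_fz⟩`. -/
theorem coercive_lattice [NeZero M] (hL : 0 < L)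
    {R : ((Fin d → ZMod M) × (Fin d → Fin L)) × Fin d → Matrix o o ℝ}
    {W : (Fin d → ZMod M) → (Fin d → ZMod M) × (Fin d → Fin L) → Matrix o o ℝ} (hW : ∀ y x, (W y x)ᵀ * W y x = 1)
    (hWstep : ∀ (y : Fin d → ZMod M) (z : Fin d → Fin L) (μ : Fin d) (h : (z μ : ℕ) + 1 < L), (∀ ν, μ < ν → (z ν : ℕ) = 0) →
      W y (y, update z μ ⟨(z μ : ℕ) + 1, h⟩) = W y (y, z) * R ((y, z), μ))
    {Q : Matrix ((Fin d → ZMod M) × o) (((Fin d → ZMod M) × (Fin d → Fin L)) × o) ℝ}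
    (hQ : ∀ (u : ((Fin d → ZMod M) × (Fin d → Fin L)) × o → ℝ) (y : Fin d → ZMod M),
      (fun a => (Q *ᵥ u) (y, a)) = ∑ x, (if x.1 = y then ((L : ℝ) ^ d)⁻¹ else 0) • (W y x *ᵥ fun b => u (x, b)))
    {Hf : Matrix (((Fin d → ZMod M) × (Fin d → Fin L)) × o) (((Fin d → ZMod M) × (Fin d → Fin L)) × o) ℝ} {wf : ℝ} (hwf : 0 ≤ wf)
    (hHf : ∀ u : ((Fin d → ZMod M) × (Fin d → Fin L)) × o → ℝ,
      wf * ∑ e : ((Fin d → ZMod M) × (Fin d → Fin L)) × Fin d,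
        ((R e *ᵥ fun b => u ((e.1.1 + ((((e.1.2 e.2 : ℕ) + 1) / L) • (Pi.single e.2 (1 : ZMod M))),
            update e.1.2 e.2 ⟨((e.1.2 e.2 : ℕ) + 1) % L, Nat.mod_lt _ hL⟩), b)) - fun b => u (e.1, b)) ⬝ᵥ
          ((R e *ᵥ fun b => u ((e.1.1 + ((((e.1.2 e.2 : ℕ) + 1) / L) • (Pi.single e.2 (1 : ZMod M))),
            update e.1.2 e.2 ⟨((e.1.2 e.2 : ℕ) + 1) % L, Nat.mod_lt _ hL⟩), b)) - fun b => u (e.1, b)) ≤ u ⬝ᵥ (Hf *ᵥ u))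
    (z : ((Fin d → ZMod M) × (Fin d → Fin L)) × o → ℝ) (hz : Q *ᵥ z = 0) :
    (((L : ℝ) ^ d)⁻¹ * wf) * (z ⬝ᵥ z) ≤ 4 * (d * ((L : ℝ) - 1)) ^ 2 * (z ⬝ᵥ (Hf *ᵥ z)) := by
  haveI : NeZero L := ⟨hL.ne'⟩
  -- the bond energies of `z`
  set F : ((Fin d → ZMod M) × (Fin d → Fin L)) × Fin d → ℝ := fun e =>
    ((R e *ᵥ fun b => z ((e.1.1 + ((((e.1.2 e.2 : ℕ) + 1) / L) • (Pi.single e.2 (1 : ZMod M))),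
        update e.1.2 e.2 ⟨((e.1.2 e.2 : ℕ) + 1) % L, Nat.mod_lt _ hL⟩), b)) - fun b => z (e.1, b)) ⬝ᵥ
      ((R e *ᵥ fun b => z ((e.1.1 + ((((e.1.2 e.2 : ℕ) + 1) / L) • (Pi.single e.2 (1 : ZMod M))),
        update e.1.2 e.2 ⟨((e.1.2 e.2 : ℕ) + 1) % L, Nat.mod_lt _ hL⟩), b)) - fun b => z (e.1, b)) with hFdef
  have hF0 : ∀ e, 0 ≤ F e := fun e => dotProduct_self_nonneg' _
  have hF : ∀ (y : Fin d → ZMod M) (z' : Fin d → Fin L) (μ : Fin d) (h : (z' μ : ℕ) + 1 < L),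
      ((R ((y, z'), μ) *ᵥ fun b => z ((y, update z' μ ⟨(z' μ : ℕ) + 1, h⟩), b)) - fun b => z ((y, z'), b)) ⬝ᵥ
        ((R ((y, z'), μ) *ᵥ fun b => z ((y, update z' μ ⟨(z' μ : ℕ) + 1, h⟩), b)) - fun b => z ((y, z'), b)) ≤ F ((y, z'), μ) := by
    intro y z' μ h
    rw [hFdef]
    dsimp only
    rw [nxt_eq_update hL y z' μ h]
  -- the covering letter: each fine site lies in exactly one block, weight `(L^d)⁻¹`
  have hcover : ∀ x : (Fin d → ZMod M) × (Fin d → Fin L), ((L : ℝ) ^ d)⁻¹ ≤ ∑ y : Fin d → ZMod M, (if x.1 = y then ((L : ℝ) ^ d)⁻¹ else 0) :=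
    fun x => by rw [Finset.sum_ite_eq Finset.univ x.1]; simp
  have h1 := mass_le_blockVar_of_fluctuation (q := fun (y : Fin d → ZMod M) (x : (Fin d → ZMod M) × (Fin d → Fin L)) =>
      if x.1 = y then ((L : ℝ) ^ d)⁻¹ else 0) hW hcover z hz
    (Φ := fun y => 4 * (d * ((L : ℝ) - 1)) ^ 2 * ∑ z' : Fin d → Fin L, ∑ μ : Fin d, F ((y, z'), μ))
    (fun y => blockVar_comb_le hL hW hWstep hQ z hF0 hF y)
  have hsum : ∑ y : Fin d → ZMod M, 4 * (d * ((L : ℝ) - 1)) ^ 2 * ∑ z' : Fin d → Fin L, ∑ μ : Fin d, F ((y, z'), μ) =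
      4 * (d * ((L : ℝ) - 1)) ^ 2 * ∑ e, F e := by rw [← Finset.mul_sum, sum_blockEnergy_eq]
  rw [hsum] at h1
  have hc : 0 ≤ 4 * (d * ((L : ℝ) - 1)) ^ 2 := by positivity
  have h2 := mul_le_mul_of_nonneg_left h1 hwf
  have h3 : wf * (4 * (d * ((L : ℝ) - 1)) ^ 2 * ∑ e, F e) ≤ 4 * (d * ((L : ℝ) - 1)) ^ 2 * (z ⬝ᵥ (Hf *ᵥ z)) := by
    have := mul_le_mul_of_nonneg_left (hHf z) hc
    linarith
  linarith

end Lattice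

end Summit.QuantumFields.BalabanUV.Beta.GAN24.DerivativeRateTransferJensenMassFreeCoercive

end
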